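import Literature.NumberTheory.Automorphic.UnipotentBinomial
import Literature.NumberTheory.Automorphic.LieAlgebraGL
import Mathlib.Algebra.CharZero.Infinite
import HarnessLib

/-!
# The logarithm of a unipotent element of an algebraic group lies in its Lie algebra
(characteristic `0`; Springer 4.4.9 with 2.4 / 3.4, Borel II.7.3)

Companion to `UnipotentBinomial.lean` and `LieAlgebraGL.lean` (namespace
`Literature.NumberTheory.Automorphic`, concrete `k`-points vocabulary: algebraic subgroups `G ≤ GL n k`
(`IsAlgebraicSubgroup`), unipotent elements (`IsUnipotentElt`), the Lie algebra `lieAlgebraGL G ⊆ 𝔤𝔩ₙ`, and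
the binomial one-parameter subgroup `t ↦ xᵗ = ∑ⱼ (t choose j) (x − 1)ʲ` of a unipotent `x`,
`unipotentBinomHom`). All proved, no named facts:

* `of_coeff_one_unipotentBinomEntryPoly` — the matrix of LINEAR coefficients (in `t`) of the entries of
  `xᵗ` is `log x := ∑ⱼ cⱼ (x − 1)ʲ` with `cⱼ` = the linear coefficient of the binomial polynomial
  `X (X−1)⋯(X−j+1)/j!` (`c₀ = 0`, `c₁ = 1`; in fact `cⱼ = (−1)^{j−1}/j`, not needed here);
* **`log_mem_lieAlgebraGL`** — for `G` algebraic over a field of characteristic `0` and `x ∈ G`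
  unipotent, `log x ∈ Lie(G)`: the curve `t ↦ xᵗ` is polynomial, lies in `G` (`unipotentBinomHom_mem`:
  a polynomial vanishing on `ℕ` vanishes) and passes through `1` at `t = 0`, so its velocity lies in
  `Lie(G)` (`coeffOneMatrix_mem_lieAlgebraGL`, Springer 4.4.9); that velocity is `log x`.
* `sum_coeff_choosePoly_smul_pow_eq_self` — for `E` with `E² = 0`, `log (1 + E) = E`
  (so a transvection `1 + E` of `G` puts `E` itself in `Lie(G)`, `sub_one_mem_lieAlgebraGL_of_sq_eq_zero`).

This is the unipotent half of "`L(G)` contains the logarithms of the unipotent elements of `G`" in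
characteristic `0` (Borel II.7.3; Humphreys 15.1), complementing `expHom_mem_of_mem_lieAlgebraGL`
(`LieAlgebraGLNilpotentExp.lean`: nilpotent elements of `Lie(G)` exponentiate into `G`). Consumer: the
Goursat–Kolchin–Ribet core for crux K1 of `Summits/HodgeConjecture/HodgeConjecture/Theses/CyclicUnitaryPowers.lean`
(cell `hodge-nonav`, memo `GKR-CORE-ROADMAP-Ax-g2` step C2: logarithms of lifted transvections put
`𝔰𝔩(Eᵢ)` inside the projections of `Lie(G°)`). Written by the prover seat `hodge-nonav-prover-Ax`.

## Mathlib

`descPochhammer`, `Polynomial.coeff_mul_C`, `Polynomial.finsetSum_coeff`; no logarithm of unipotent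
matrices in Mathlib (searched `Nilpotent.log`, `unipotent` + `log`).

## References

* [SpringerLAG1998] T. A. Springer, *Linear Algebraic Groups*, 2nd ed. (1998), 2.4.5, 3.4, 4.1.3, 4.4.9.
* [Borel1991] A. Borel, *Linear Algebraic Groups*, 2nd ed., GTM 126 (1991), II.7.3 (algebraic groups in
  characteristic `0`: `exp` and `log` between unipotent elements and nilpotent elements of `L(G)`).
-/

open scoped MatrixGroups

namespace Literature.NumberTheory.Automorphic

open _root_.Polynomial

variable {k : Type*} [Field k] {n : Type*} [Fintype n] [DecidableEq n]

/-! ### Linear coefficients of the binomial polynomials -/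

omit [Fintype n] [DecidableEq n] in
/-- `(X choose 0) = 1` has no linear term. [folklore] -/
private theorem coeff_one_choosePoly_zero : (choosePoly k 0).coeff 1 = 0 := by
  rw [choosePoly_zero, coeff_one]
  rfl

omit [Fintype n] [DecidableEq n] in
/-- `(X choose 1) = X` has linear coefficient `1`. [folklore] -/
private theorem coeff_one_choosePoly_one : (choosePoly k 1).coeff 1 = 1 := by
  rw [choosePoly, descPochhammer_one, Nat.factorial_one, Nat.cast_one, inv_one, C_1, one_mul, coeff_X_one]

/-- **The velocity of `t ↦ xᵗ` is `log x`**: the matrix of linear coefficients of the entry polynomials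
`unipotentBinomEntryPoly x a b` of `xᵗ` is `∑ⱼ cⱼ (x − 1)ʲ`, `cⱼ` the linear coefficient of
`(X choose j)`. [cite: Borel1991, II.7.3] -/
theorem of_coeff_one_unipotentBinomEntryPoly (x : Matrix n n k) :
    (Matrix.of fun a b => (unipotentBinomEntryPoly x a b).coeff 1) =
      ∑ j ∈ Finset.range (Fintype.card n), (choosePoly k j).coeff 1 • (x - 1) ^ j := by
  ext a b
  simp only [Matrix.of_apply, unipotentBinomEntryPoly, finsetSum_coeff, coeff_mul_C, Matrix.sum_apply,
    Matrix.smul_apply, smul_eq_mul]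

omit [Fintype n] [DecidableEq n] in
/-- **`log (1 + E) = E` when `E² = 0`**: `∑_{j<m} cⱼ Eʲ = c₀ • 1 + c₁ • E = E` for `m ≥ 2` (the logarithm series
of Borel II.7.3 truncated after its linear term). [cite: Borel1991, II.7.3] -/
theorem sum_coeff_choosePoly_smul_pow_eq_self {m : ℕ} (hm : 2 ≤ m) {ι : Type*} [Fintype ι] [DecidableEq ι]
    {E : Matrix ι ι k} (hE : E * E = 0) :
    ∑ j ∈ Finset.range m, (choosePoly k j).coeff 1 • E ^ j = E := by
  obtain ⟨m, rfl⟩ := Nat.exists_eq_add_of_le hm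
  rw [Finset.sum_range_add _ 2 m, Finset.sum_range_succ, Finset.sum_range_succ, Finset.sum_range_zero,
    zero_add, pow_zero, pow_one, coeff_one_choosePoly_zero, coeff_one_choosePoly_one, zero_smul, zero_add,
    one_smul, add_eq_left]
  refine Finset.sum_eq_zero fun j _ => ?_
  rw [pow_add, pow_two, hE, zero_mul, smul_zero]

/-! ### `log x ∈ Lie(G)` for unipotent `x ∈ G` -/

variable [CharZero k]

/-- **The logarithm of a unipotent element of an algebraic group lies in its Lie algebra**
(characteristic `0`). For `G ≤ GL n k` algebraic and `x ∈ G` unipotent,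
`log x = ∑ⱼ cⱼ (x − 1)ʲ ∈ lieAlgebraGL G` (`cⱼ` the linear coefficient of `(X choose j)`): the binomial
curve `t ↦ xᵗ` has polynomial coordinates, lies in `G` for all `t` (`unipotentBinomHom_mem`) and is `1`
at `t = 0`, so its velocity — this matrix (`of_coeff_one_unipotentBinomEntryPoly`) — is a tangent vector
of `G` at `1` (`coeffOneMatrix_mem_lieAlgebraGL`). [cite: Borel1991, II.7.3] [cite: SpringerLAG1998, 4.4.9] -/
theorem log_mem_lieAlgebraGL {G : Subgroup (GL n k)} (hG : IsAlgebraicSubgroup G) {x : GL n k}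
    (hx : IsUnipotentElt x) (hxG : x ∈ G) :
    (∑ j ∈ Finset.range (Fintype.card n), (choosePoly k j).coeff 1 • ((x : Matrix n n k) - 1) ^ j) ∈
      lieAlgebraGL G := by
  have hmem : ∀ t : k, unipotentBinomHom hx (Multiplicative.ofAdd t) ∈ G := fun t =>
    unipotentBinomHom_mem hx hG hxG t
  rw [← of_coeff_one_unipotentBinomEntryPoly]
  refine coeffOneMatrix_mem_lieAlgebraGL (G := G) (fun t => ⟨unipotentBinomHom hx (Multiplicative.ofAdd t), hmem t⟩)
    (Sum.elim (fun ab => unipotentBinomEntryPoly (x : Matrix n n k) ab.1 ab.2) fun _ => 1) ?_ ?_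
  · intro t c
    rcases c with ⟨a, b⟩ | u
    · rw [Sum.elim_inl, glCoordFun_inl, coe_unipotentBinomHom, unipotentBinom_apply]
    · rw [Sum.elim_inr, glCoordFun_inr, coe_unipotentBinomHom, det_unipotentBinom hx, inv_one, eval_one]
  · refine Subtype.ext ?_
    change unipotentBinomHom hx (Multiplicative.ofAdd 0) = 1
    rw [ofAdd_zero, map_one]

/-- In particular **a transvection-like element `x = 1 + E` (`E² = 0`) of an algebraic group puts `E` in
its Lie algebra**: `x − 1 ∈ lieAlgebraGL G` (characteristic `0`, `|n| ≥ 2`). [cite: Borel1991, II.7.3] -/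
theorem sub_one_mem_lieAlgebraGL_of_sq_eq_zero {G : Subgroup (GL n k)} (hG : IsAlgebraicSubgroup G)
    {x : GL n k} (hxG : x ∈ G) (hE : ((x : Matrix n n k) - 1) * ((x : Matrix n n k) - 1) = 0)
    (hn : 2 ≤ Fintype.card n) : (x : Matrix n n k) - 1 ∈ lieAlgebraGL G := by
  have hx : IsUnipotentElt x := ⟨2, by rw [pow_two, hE]⟩
  have h := log_mem_lieAlgebraGL hG hx hxG
  rwa [sum_coeff_choosePoly_smul_pow_eq_self hn hE] at h

end Literature.NumberTheory.Automorphic
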